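import Summits.KontsevichZagierPeriods.KontsevichZagierPeriods.Theorems.RealEllipticSectorKernel.Negative.CMPoint
import Summits.KontsevichZagierPeriods.KontsevichZagierPeriods.Theorems.RealEllipticSectorKernel.Negative.SecondKindCM66

/-!
# `RealEllipticSectorKernel` (stmt-KontsevichZagierPeriods-10632), negative side: the second integer relation at `j = 66³`

cdisprove finding F9b (commentary in `Cruxes/RealEllipticSectorKernel/Disproof.lean` §9b): at
`(q₂,q₃) = (44,−56)` the crux's four periods satisfy, besides `J₀ = 2K₀` (`Negative/CMPoint.lean`), the
INTEGER quasi-period relation **`2J₀ − J₁ − 2K₁ = 0`** (`two_J₀_sub_J₁_sub_two_K₁_cm`; closed forms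
`J₁_cm`, `K₁_cm` modulo the lemniscatic second-kind constant `M₄`), proved by the rational 2-isogeny
(`Negative/SecondKindCM66.lean`). Hence a second, independent failure of the `ℚ`-rigidity
(`not_qRigidity_cm₂`) and a second honest kernel element
`cmElem₂ = 2[σ,1/√f] − [σ,x/√f] − 2[σ′,x/√(−f)]` (`eval_cmElem₂`, `coeffSum = −1`), a relation if the
summit holds (`cmElem₂_mem_relations_of_summit`): the `ℤ`-kernel of this CM sector has rank ≥ 2 and the
unconditional statement needs first- AND second-kind isogeny transfers (the analogue of the route's
CMTwist pair at `j = 8000`), neither filed.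

Sources: M. Kontsevich, D. Zagier, *Periods* (2001), §§1.1–1.2; J. Vélu, *Isogénies entre courbes
elliptiques*, C. R. Acad. Sci. Paris 273 (1971) 238–241; D. Masser, *Elliptic Functions and
Transcendence*, LNM 437 (1975), Ch. III, Lemma 3.1 (CM quasi-period relations). -/

noncomputable section

namespace Summit.KontsevichZagierPeriods.RealEllipticSectorKernel.CMPointSecondKind

open MeasureTheory Set
open Literature.NumberTheory.Transcendental Literature.ModelTheory.ExponentialFields
open Summit.KontsevichZagierPeriods.RealEllipticSectorKernel.Negative
open Summit.KontsevichZagierPeriods.RealEllipticSectorKernel.Ovals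
open Summit.KontsevichZagierPeriods.RealEllipticSectorKernel.CMPoint
open Summit.KontsevichZagierPeriods.HermiteRigidity.GenusTwoCycleTransferNegative (setIntegral_fin_one integrableOn_fin_one)

/-- `x/√f` is `ℚ`-semialgebraic on the root-free oval `σ` (every curve). [cite: BochnakCosteRoy1998, Prop. 2.2.6] -/
theorem isSemialgebraicFunOn_x_div_sqrt_cubic (q₂ q₃ : ℚ) :
    IsSemialgebraicFunOn ℚ (σ₁ q₂ q₃) (fun p => p 0 / Real.sqrt (cubic q₂ q₃ (p 0))) := by
  have h1 : IsSemialgebraicFunOn ℚ (σ₁ q₂ q₃) (fun p => MvPolynomial.aeval p (MvPolynomial.X 0 : MvPolynomial (Fin 1) ℚ)) :=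
    isSemialgebraicFunOn_aeval (isSemialgebraic_σ₁ q₂ q₃) _
  have h2 := IsSemialgebraicFunOn.mul_holds h1 (isSemialgebraicFunOn_inv_sqrt_cubic q₂ q₃)
  refine h2.congr (fun p _ => ?_)
  simp only [MvPolynomial.aeval_X, Pi.mul_apply]
  ring

/-- `x/√(−f)` is `ℚ`-semialgebraic on the root-free interval `σ'` (every curve). [cite: BochnakCosteRoy1998, Prop. 2.2.6] -/
theorem isSemialgebraicFunOn_x_div_sqrt_neg_cubic (q₂ q₃ : ℚ) :
    IsSemialgebraicFunOn ℚ (σ₂ q₂ q₃) (fun p => p 0 / Real.sqrt (-cubic q₂ q₃ (p 0))) := by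
  have h1 : IsSemialgebraicFunOn ℚ (σ₂ q₂ q₃) (fun p => MvPolynomial.aeval p (MvPolynomial.X 0 : MvPolynomial (Fin 1) ℚ)) :=
    isSemialgebraicFunOn_aeval (isSemialgebraic_σ₂ q₂ q₃) _
  have h2 := IsSemialgebraicFunOn.mul_holds h1 (isSemialgebraicFunOn_inv_sqrt_neg_cubic q₂ q₃)
  refine h2.congr (fun p _ => ?_)
  simp only [MvPolynomial.aeval_X, Pi.mul_apply]
  ring

/-- **(F9b)** `J₁(44,−56) = Λ/2 − 2M₄` (`M₄ = ∫₀¹ w dw/√(4w−4w³)`). [folklore] -/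
theorem J₁_cm : J₁ 44 (-56) = CM66.lemHalf - 2 * CM66.M₄ := by
  unfold J₁
  rw [σ₁_cm]
  have h := setIntegral_fin_one (fun x => x / Real.sqrt (CM66.fcm x)) (Ioo CM66.e₃ CM66.e₂)
  simp only [mem_Ioo] at h
  simp only [cubic_cm]
  rw [h, ← CM66.integral_J1_cm]
  refine integral_congr_ae (Filter.Eventually.of_forall fun x => ?_)
  simp only [div_eq_mul_inv]

/-- **(F9b)** `K₁(44,−56) = Λ/4 + M₄`. [folklore] -/
theorem K₁_cm : K₁ 44 (-56) = CM66.lemHalf / 2 + CM66.M₄ := by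
  unfold K₁
  rw [σ₂_cm]
  have h := setIntegral_fin_one (fun x => x / Real.sqrt (-CM66.fcm x)) (Ioo CM66.e₂ 2)
  simp only [mem_Ioo] at h
  simp only [cubic_cm]
  rw [h, ← CM66.integral_K1_cm]
  refine integral_congr_ae (Filter.Eventually.of_forall fun x => ?_)
  simp only [div_eq_mul_inv]

/-- **(F9b) The second integer period relation at `j = 66³`: `2J₀ − J₁ − 2K₁ = 0`** (quasi-period
CM relation with RATIONAL coefficients; proved by the same rational 2-isogeny — first kind on the
oval for `J₁`, the form `(2−x)/((x−1)²√(−f))` on `σ'` for `K₁` — plus two Newton–Leibniz steps).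
[cite: Masser1975, Lemma 3.1] -/
theorem two_J₀_sub_J₁_sub_two_K₁_cm : 2 * J₀ 44 (-56) - J₁ 44 (-56) - 2 * K₁ 44 (-56) = 0 := by
  rw [J₀_cm, J₁_cm, K₁_cm]; ring

/-- **(F9b)** A second, independent failure of the `ℚ`-rigidity at `(44,−56)`:
`(b,c,d,e) = (2,−1,0,−2)`. [folklore] -/
theorem not_qRigidity_cm₂ :
    ¬ ∀ b c d e : ℚ, (b : ℝ) * J₀ 44 (-56) + (c : ℝ) * J₁ 44 (-56) + (d : ℝ) * K₀ 44 (-56) +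
      (e : ℝ) * K₁ 44 (-56) = 0 → b = 0 ∧ c = 0 ∧ d = 0 ∧ e = 0 := by
  intro h
  have := h 2 (-1) 0 (-2) (by
    have := two_J₀_sub_J₁_sub_two_K₁_cm
    push_cast; linarith)
  norm_num at this

/-- The generator `[σ, x/√f]` at `(44,−56)` as an honest representation. [cite: KontsevichZagier2001, §1.1] -/
def genσxCM : KZ.IntegralRep 1 where
  domain := σ₁ 44 (-56)
  integrand := fun p => p 0 / Real.sqrt (cubic 44 (-56) (p 0))
  isSemialgebraic_domain := isSemialgebraic_σ₁ 44 (-56)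
  isSemialgebraicFunOn_integrand := isSemialgebraicFunOn_x_div_sqrt_cubic 44 (-56)
  integrableOn := by
    have h := integrableOn_fin_one (CM66.integrableOn_mul_invSqrt_pos (φ := fun x => x) (by fun_prop))
    have h2 : IntegrableOn (fun p : Fin 1 → ℝ => p 0 / Real.sqrt (cubic 44 (-56) (p 0)))
        {p | p 0 ∈ Ioo CM66.e₃ CM66.e₂} :=
      h.congr_fun (fun p _ => by simp only [cubic_cm, div_eq_mul_inv])
        (measurableSet_Ioo.preimage (measurable_pi_apply 0))
    rw [σ₁_cm]
    exact h2

/-- The generator `[σ', x/√(−f)]` at `(44,−56)` as an honest representation. [cite: KontsevichZagier2001, §1.1] -/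
def genσ'xCM : KZ.IntegralRep 1 where
  domain := σ₂ 44 (-56)
  integrand := fun p => p 0 / Real.sqrt (-cubic 44 (-56) (p 0))
  isSemialgebraic_domain := isSemialgebraic_σ₂ 44 (-56)
  isSemialgebraicFunOn_integrand := isSemialgebraicFunOn_x_div_sqrt_neg_cubic 44 (-56)
  integrableOn := by
    have h := integrableOn_fin_one (CM66.integrableOn_mul_invSqrt_neg (φ := fun x => x) (by fun_prop))
    have h2 : IntegrableOn (fun p : Fin 1 → ℝ => p 0 / Real.sqrt (-cubic 44 (-56) (p 0)))
        {p | p 0 ∈ Ioo CM66.e₂ 2} :=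
      h.congr_fun (fun p _ => by simp only [cubic_cm, div_eq_mul_inv])
        (measurableSet_Ioo.preimage (measurable_pi_apply 0))
    rw [σ₂_cm]
    exact h2

/-- Value of `[σ, x/√f]`. [folklore] -/
theorem genσxCM_value : genσxCM.value = CM66.lemHalf - 2 * CM66.M₄ := J₁_cm
/-- Value of `[σ', x/√(−f)]`. [folklore] -/
theorem genσ'xCM_value : genσ'xCM.value = CM66.lemHalf / 2 + CM66.M₄ := K₁_cm

/-- **The second CM kernel element** `u₁ = 2[σ,1/√f] − [σ,x/√f] − 2[σ',x/√(−f)]` at `(44,−56)`.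
[cite: KontsevichZagier2001, §1.2] -/
def cmElem₂ : KZ.FormalRep := 2 • KZ.of genσCM - KZ.of genσxCM - 2 • KZ.of genσ'xCM

/-- `[σ, x/√f] ∈ S` (`m = 1`). [folklore] -/
theorem genσxCM_mem_gens : KZ.of genσxCM ∈ Gens 44 (-56) :=
  Or.inl (Or.inl ⟨genσxCM, 1, rfl, fun p _ => by simp [genσxCM], rfl⟩)

/-- `[σ', x/√(−f)] ∈ S` (`m = 1`). [folklore] -/
theorem genσ'xCM_mem_gens : KZ.of genσ'xCM ∈ Gens 44 (-56) :=
  Or.inl (Or.inr ⟨genσ'xCM, 1, rfl, fun p _ => by simp [genσ'xCM], rfl⟩)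

/-- `u₁ ∈ closure S`. [folklore] -/
theorem cmElem₂_mem_closure : cmElem₂ ∈ AddSubgroup.closure (Gens 44 (-56)) :=
  sub_mem (sub_mem (AddSubgroup.nsmul_mem _ (AddSubgroup.subset_closure genσCM_mem_gens) 2)
    (AddSubgroup.subset_closure genσxCM_mem_gens))
    (AddSubgroup.nsmul_mem _ (AddSubgroup.subset_closure genσ'xCM_mem_gens) 2)

/-- **(F9b)** `eval u₁ = 2J₀ − J₁ − 2K₁ = 0`: a second honest kernel element at the CM curve, involving
the periods of the SECOND kind — the `ℤ`-kernel of this sector has rank ≥ 2. [folklore] -/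
theorem eval_cmElem₂ : KZ.eval cmElem₂ = 0 := by
  have h := two_J₀_sub_J₁_sub_two_K₁_cm
  rw [J₀_cm, J₁_cm, K₁_cm] at h
  simp only [cmElem₂, map_sub, map_nsmul, KZ.eval_of, genσCM_value, genσxCM_value, genσ'xCM_value]
  simp only [nsmul_eq_mul, Nat.cast_ofNat]
  linarith

/-- `u₁` has coefficient sum `−1`: every derivation uses an additivity move. [folklore] -/
theorem cmElem₂_not_mem_closure_cov_nl :
    cmElem₂ ∉ AddSubgroup.closure (KZ.changeOfVariablesRel ∪ KZ.newtonLeibnizRel) := by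
  intro h
  have h0 := KZ.closure_cov_nl_le_ker_coeffSum h
  rw [AddMonoidHom.mem_ker] at h0
  simp [cmElem₂, map_sub, map_nsmul, KZ.coeffSum_of] at h0

/-- The summit predicts `u₁ ∈ relations`: a quasi-period isogeny transfer (the analogue of the
route's `CMTwistQuasiPeriodTransfer` at `j = 8000`) that the route does not have. [cite: KontsevichZagier2001, §1.2] -/
theorem cmElem₂_mem_relations_of_summit (h : _root_.KontsevichZagierPeriods) :
    cmElem₂ ∈ KZ.relations :=
  (kzKernelConjecture_iff_isRational.mpr h) cmElem₂ eval_cmElem₂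

end Summit.KontsevichZagierPeriods.RealEllipticSectorKernel.CMPointSecondKind

end
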